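import Mathlib
import Summits.NavierStokesRegularity.FluidComputer.AbcClassIIComplexBasesReality
import Summits.NavierStokesRegularity.FluidComputer.CertificateAbcSpectrumThird

/-!
# GROUP-B, CLASS II — TWO IMPLEMENTATIONS CERTIFY THE **SAME** EIGENVALUE (kernel form of the AGREEMENT RULE)
(profile-cert-3 g8, cell `ns-blowup`, 2026-08-27)

HONEST FRAMING (human rulings D-0035/D-0074): nothing here is a claim about Navier–Stokes blow-up.
WHAT THIS IS NOT: not NS evidence. MODEL lane (NS linearised about the forced ABC flow `abcFlow 1 1 1`,
class II); no certificate, number or census word moves. The cell's AGREEMENT RULE (HOME/profile/cert/PLAN.md §1: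
«the two discs intersect and their union lies inside both isolation discs, so the two implementations certify
the SAME simple eigenvalue») was a PAPER sentence; its numeric half is kernel since cert-2/cert-3 g0–g2
(`CertificateAbcSpectrum*.discs_meet*`). This file makes the analytic half kernel for the 3-B-nested rows typed
over COMPLEX orbit bases (every CR implementation computes in such a basis, cert-3 g8):
* `eq_of_coord_eigenvector_of_isolated` — two complex orthonormal orbit-basis families `wf₁`, `wf₂` (each:
  supported on the orbit, transversal, class II, orthonormal per orbit) with complex first-order matrices `amc₁`,
  `amc₂`: IF `λ₁` has a non-zero `amc₁`-coordinate eigenvector with all polynomial moments finite (conclusion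
  COORDINATES of `isLinNSEigenvalue_near_of_nested_certificate_of_complex_bases` for implementation 1) and `λ₂` is
  ISOLATED within `r` in `amc₂`-coordinates (conclusion ISOLATION for implementation 2) and `‖λ₁ − λ₂‖ < r`, THEN
  `λ₁ = λ₂` — the eigenvector is moved to instab4's real basis (`ccoord_transfer`, family 1) and into family 2
  (`ccoord_transfer_back`), where isolation kills it unless the eigenvalues coincide;
* `norm_sub_lt_of_discs` — the triangle inequality turning the printed disc data into `‖λ₁ − λ₂‖ < r`;
* `row3002_BC_norm_sub_lt` — the numeric instance for the T1 row (R = 300, class II, implementations B and C) from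
  `CertificateAbcSpectrum.Row3002C.discs_meet_B` (file `CertificateAbcSpectrumThird`) BY NAME.
Mathlib + the files named; no new definitions. bears_on LADDER-NS N5 / Z4-a(1) («two implementations»). [folklore].
-/

noncomputable section

open scoped BigOperators ComplexConjugate InnerProductSpace
open Finset

namespace Summit.NavierStokesRegularity.FluidComputer.AbcClassIIEigenpair

open Literature.Analysis.FunctionSpaces Literature.Analysis.FunctionSpaces.Torus
open Literature.Analysis.FunctionSpaces.EuclideanSpace
open Literature.Analysis.FluidPDE Literature.Analysis.FluidPDE.SteadyLattice
open Summit.NavierStokesRegularity.FluidComputer.AbcClassII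
open Summit.NavierStokesRegularity.FluidComputer.CertificateAbcSpectrum

section Agreement

variable (wf₁ : Idx → Fam)
variable (hws₁ : ∀ i : Idx, ∀ k ∉ i.1.1, wf₁ i k = 0)
variable (hwt₁ : ∀ (i : Idx) (k : Fin 3 → ℤ), ∑ j : Fin 3, ((k j : ℤ) : ℂ) * wf₁ i k j = 0)
variable (hwII₁ : ∀ i : Idx, IsClassII (wf₁ i))
variable (hwon₁ : ∀ (O : Orbit) (a b : Fin (odim O)),
  ∑ k ∈ O.1, (inner ℂ (wf₁ ⟨O, a⟩ k) (wf₁ ⟨O, b⟩ k) : ℂ) = if a = b then 1 else 0)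
variable (amc₁ : Idx → Idx → ℂ)
variable (hamc₁ : ∀ i j : Idx, amc₁ i j =
  ∑ k ∈ i.1.1, (inner ℂ (wf₁ i k) (Torus.lerayCoeff k (crossForm 1 1 1 (wf₁ j) k)) : ℂ))
variable (wf₂ : Idx → Fam)
variable (hws₂ : ∀ i : Idx, ∀ k ∉ i.1.1, wf₂ i k = 0)
variable (hwt₂ : ∀ (i : Idx) (k : Fin 3 → ℤ), ∑ j : Fin 3, ((k j : ℤ) : ℂ) * wf₂ i k j = 0)
variable (hwII₂ : ∀ i : Idx, IsClassII (wf₂ i))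
variable (hwon₂ : ∀ (O : Orbit) (a b : Fin (odim O)),
  ∑ k ∈ O.1, (inner ℂ (wf₂ ⟨O, a⟩ k) (wf₂ ⟨O, b⟩ k) : ℂ) = if a = b then 1 else 0)
variable (amc₂ : Idx → Idx → ℂ)
variable (hamc₂ : ∀ i j : Idx, amc₂ i j =
  ∑ k ∈ i.1.1, (inner ℂ (wf₂ i k) (Torus.lerayCoeff k (crossForm 1 1 1 (wf₂ j) k)) : ℂ))

include hws₁ hwt₁ hwII₁ hwon₁ hamc₁ hws₂ hwt₂ hwII₂ hwon₂ hamc₂ in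
/-- **Two implementations certify the SAME eigenvalue**: a coordinate eigenvector for `λ₁` in family 1 with all
moments finite, isolation of `λ₂` within `r` in family 2, and `‖λ₁ − λ₂‖ < r` force `λ₁ = λ₂`. -/
theorem eq_of_coord_eigenvector_of_isolated {R : ℝ} (hR : 1 ≤ R) (lam₁ lam₂ : ℂ) {r : ℝ}
    (hcoord : ∃ w : Idx → ℂ, w ≠ 0 ∧
      (∀ i : Idx, ((-(onormSq i.1 / R) : ℝ) : ℂ) * w i +
        ∑ j ∈ nbrIdx i, amc₁ i j * w j = lam₁ * w i) ∧
      ∀ s : ℕ, Summable fun i : Idx => (1 + onormSq i.1) ^ s * ‖w i‖ ^ 2)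
    (hisol : ∀ z : ℂ, z ≠ lam₂ → ‖z - lam₂‖ < r →
      ∀ w : Idx → ℂ, (Summable fun i : Idx => (1 + onormSq i.1 / R) ^ 2 * ‖w i‖ ^ 2) →
        (∀ i : Idx, ((-(onormSq i.1 / R) : ℝ) : ℂ) * w i +
          ∑ j ∈ nbrIdx i, amc₂ i j * w j = z * w i) → w = 0)
    (hdist : ‖lam₁ - lam₂‖ < r) : lam₁ = lam₂ := by
  classical
  have hR0 : 0 < R := by linarith
  by_contra hne
  obtain ⟨w, hw0, hE, hsum⟩ := hcoord
  -- family 1 → instab4's real basis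
  obtain ⟨wa, -, hEa, hsumsA, hneA⟩ := ccoord_transfer wf₁ hws₁ hwt₁ hwII₁ hwon₁ amc₁ hamc₁ lam₁ w hE
  -- real basis → family 2
  obtain ⟨wb, -, hEb, hsumsB, hneB⟩ := ccoord_transfer_back wf₂ hws₂ hwt₂ hwII₂ hwon₂ amc₂ hamc₂ lam₁ wa hEa
  have hsumsBW : ∀ (n : ℕ) (g : Orbit → ℝ), ∑ i ∈ cubeIdx n, g i.1 * ‖wb i‖ ^ 2 =
      ∑ i ∈ cubeIdx n, g i.1 * ‖w i‖ ^ 2 := fun n g => by rw [hsumsB n g, hsumsA n g]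
  have hwsumB : Summable fun i : Idx => (1 + onormSq i.1 / R) ^ 2 * ‖wb i‖ ^ 2 := by
    have h2 : Summable fun i : Idx => (1 + onormSq i.1) ^ 2 * ‖wb i‖ ^ 2 :=
      summable_of_cube_sums (fun i => (1 + onormSq i.1) ^ 2)
        (fun i => pow_nonneg (by linarith [onormSq_nonneg i.1]) _) w wb
        (fun n => hsumsBW n (fun O => (1 + onormSq O) ^ 2)) (hsum 2)
    refine Summable.of_nonneg_of_le (fun i => mul_nonneg (sq_nonneg _) (sq_nonneg _)) (fun i => ?_) h2
    have h3 : 1 + onormSq i.1 / R ≤ 1 + onormSq i.1 := by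
      have h4 : onormSq i.1 / R ≤ onormSq i.1 := div_le_self (onormSq_nonneg i.1) hR
      linarith
    have h5 : 0 ≤ 1 + onormSq i.1 / R := by linarith [div_nonneg (onormSq_nonneg i.1) hR0.le]
    exact mul_le_mul_of_nonneg_right (pow_le_pow_left₀ h5 h3 2) (sq_nonneg _)
  have hwb0 : wb ≠ 0 := hneB (hneA hw0)
  exact hwb0 (hisol lam₁ hne hdist wb hwsumB hEb)

end Agreement

/-- **Disc data ⇒ distance**: `‖λ₁ − λ̃₁‖ ≤ ρ₁`, `‖λ₂ − λ̃₂‖ ≤ ρ₂` and `ρ₁ + ρ₂ + ‖λ̃₁ − λ̃₂‖ < r` give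
`‖λ₁ − λ₂‖ < r`. -/
theorem norm_sub_lt_of_discs {lam₁ lam₂ lt₁ lt₂ : ℂ} {ρ₁ ρ₂ r : ℝ} (h₁ : ‖lam₁ - lt₁‖ ≤ ρ₁)
    (h₂ : ‖lam₂ - lt₂‖ ≤ ρ₂) (h : ρ₁ + ρ₂ + ‖lt₁ - lt₂‖ < r) : ‖lam₁ - lam₂‖ < r := by
  have e : lam₁ - lam₂ = (lam₁ - lt₁) + (lt₁ - lt₂) - (lam₂ - lt₂) := by ring
  rw [e]
  calc ‖(lam₁ - lt₁) + (lt₁ - lt₂) - (lam₂ - lt₂)‖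
      ≤ ‖(lam₁ - lt₁) + (lt₁ - lt₂)‖ + ‖lam₂ - lt₂‖ := norm_sub_le _ _
    _ ≤ ‖lam₁ - lt₁‖ + ‖lt₁ - lt₂‖ + ‖lam₂ - lt₂‖ := by gcongr; exact norm_add_le _ _
    _ < r := by linarith

/-- **T1 row (R = 300, class II), implementations B and C**: eigenvalues certified within `Row3002C.rhoB` of
`λ̃_B` and within `Row3002C.rho` of `λ̃_C` are closer than BOTH isolation radii `Row3002C.rIso` and
`Row3002C.rIsoB` (`Row3002C.discs_meet_B` BY NAME; `λ̃_B`, `λ̃_C` real). -/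
theorem row3002_BC_norm_sub_lt {lamB lamC : ℂ}
    (hB : ‖lamB - (((Row3002C.lamReB : ℚ) : ℝ) : ℂ)‖ ≤ ((Row3002C.rhoB : ℚ) : ℝ))
    (hC : ‖lamC - (((Row3002C.lamRe : ℚ) : ℝ) : ℂ)‖ ≤ ((Row3002C.rho : ℚ) : ℝ)) :
    ‖lamB - lamC‖ < ((Row3002C.rIso : ℚ) : ℝ) ∧ ‖lamC - lamB‖ < ((Row3002C.rIsoB : ℚ) : ℝ) := by
  obtain ⟨h0, hi, -, hB', hC'⟩ := Row3002C.discs_meet_B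
  have hIm : Row3002C.lamImB - Row3002C.lamIm = 0 := by norm_num [Row3002C.lamImB, Row3002C.lamIm]
  rw [hIm, add_zero] at hB' hC'
  have hd : ‖(((Row3002C.lamReB : ℚ) : ℝ) : ℂ) - (((Row3002C.lamRe : ℚ) : ℝ) : ℂ)‖ =
      ((Row3002C.lamReB - Row3002C.lamRe : ℚ) : ℝ) := by
    rw [← Complex.ofReal_sub, Complex.norm_real, Real.norm_eq_abs]
    push_cast
    exact abs_of_nonneg (by exact_mod_cast h0)
  have hd' : ‖(((Row3002C.lamRe : ℚ) : ℝ) : ℂ) - (((Row3002C.lamReB : ℚ) : ℝ) : ℂ)‖ =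
      ((Row3002C.lamReB - Row3002C.lamRe : ℚ) : ℝ) := by rw [norm_sub_rev]; exact hd
  have hC'' : ((Row3002C.rhoB : ℚ) : ℝ) + ((Row3002C.rho : ℚ) : ℝ) +
      ((Row3002C.lamReB - Row3002C.lamRe : ℚ) : ℝ) < ((Row3002C.rIso : ℚ) : ℝ) := by
    have h := (Rat.cast_lt (K := ℝ)).mpr hC'
    push_cast at h ⊢; linarith
  have hB'' : ((Row3002C.rho : ℚ) : ℝ) + ((Row3002C.rhoB : ℚ) : ℝ) +
      ((Row3002C.lamReB - Row3002C.lamRe : ℚ) : ℝ) < ((Row3002C.rIsoB : ℚ) : ℝ) := by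
    have h := (Rat.cast_lt (K := ℝ)).mpr hB'
    push_cast at h ⊢; linarith
  refine ⟨norm_sub_lt_of_discs hB hC (by rw [hd]; exact hC''), norm_sub_lt_of_discs hC hB (by rw [hd']; exact hB'')⟩

end Summit.NavierStokesRegularity.FluidComputer.AbcClassIIEigenpair

end
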